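import Literature.MathematicalPhysics.QuantumFieldTheory.OSMeanValueRealIdentity
import Literature.MathematicalPhysics.QuantumFieldTheory.OSMeanValueCoords
import Literature.MathematicalPhysics.QuantumLattice.SchwartzLocalDensity
import Literature.Analysis.Complex.HolomorphicParametricIntegral
import Literature.Analysis.Complex.RealEnvironment
import Literature.Analysis.Complex.OsgoodProofs
import HarnessLib

/-!
# The smeared continuation equals the sector extension of the skeleton (OS II, Ch. VI.1 (6.6)–(6.9))

Topic `Literature/MathematicalPhysics/QuantumFieldTheory`; support file (all proved; the two
holomorphic functions as definitions; no named facts) for the mean-value step of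
Osterwalder–Schrader II, Ch. VI.1 toward the temperedness estimate (4.5) with exponent linear in
the number of points. Two holomorphic functions of the complex configuration `ζ` near `cfgPt x`:

* `mvTheta` — the local holomorphic density `S` smeared, in the frame coordinates `c` of every
  point, against the product profiles: `Θ_v(ζ) = ∫ S(ζ + cfgPt(frameMap∘c)) ∏ⱼ prodProfile vⱼ (cⱼ) dc`;
* `mvGamma` — the sector extension of the skeleton smeared with the frame profiles `κ_v`
  (`OSFrameProfiles.frameProfile`), transported to configuration space:
  `Γ_v(ζ) = geomG b κ_v (cplxL L (ζ − cfgPt pbase))`, `L = posLin⁻¹`;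

and the theorem `mvTheta_eq_mvGamma`: **they agree on a ball about `cfgPt x`** — both are
holomorphic (`differentiableOn_mvTheta`: dominated holomorphic parameter integral;
`differentiableOn_mvGamma`), they agree at the real points
(`mvTheta_cfgPt`: `OSFrameProfiles.integral_mul_prod_prodProfile_eq` and
`OSMeanValueRealIdentity.integral_density_mul_tensorFin_eq_geomG`), hence everywhere by the real
environment theorem (`RealEnvironment.eventually_eq_of_eq_on_reals_pi₂`) and the identity theorem.
This is the device by which the pointwise values of the continued Schwinger function are controlled
by E0' through the sector bound `norm_geomG_le`.

## References

* K. Osterwalder, R. Schrader, *Axioms for Euclidean Green's functions II*, Comm. Math. Phys. 42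
  (1975) 281–305, Ch. VI.1 (6.5)–(6.9). [OsterwalderSchraderCMP1975]
-/

noncomputable section

open MeasureTheory Complex Set Metric Filter
open _root_.Topology
open scoped InnerProductSpace RealInnerProductSpace SchwartzMap NNReal Real

namespace Literature.MathematicalPhysics.QuantumFieldTheory

open Literature.MathematicalPhysics.QuantumLattice (SchwingerFamily IsPositiveTimeMulti schwartzNorm)
open Literature.MathematicalPhysics.QuantumLattice.SchwingerFamily
open Literature.MathematicalPhysics.QuantumLattice.SchwingerFamily.OSSpace
open Literature.Analysis.FunctionSpaces.SchwartzAverage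
open Literature.Analysis.Distribution
open Literature.Analysis.Complex
open OSFrames

variable {d : ℕ} [NeZero d]

/-! ### The two holomorphic functions -/

section Defs

variable (𝔖 : SchwingerFamily (EuclideanSpace ℝ (Fin d))) {k : ℕ}
  (ξ : Fin (k + 1) → EuclideanSpace ℝ (Fin d)) (ê : Fin d → EuclideanSpace ℝ (Fin d)) (hli : LinearIndependent ℝ ê)
  (b : ℝ) (n₀ : ℕ) {r₁ : ℝ} (hr₁ : 0 < r₁)

/-- The complex shift by the frame coordinates `c`: `cfgPt (frameMap∘c)`. [folklore] -/
def frameShift (c : Fin (k + 2) → EuclideanSpace ℝ (Fin d)) : Fin (k + 2) → Fin d → ℂ :=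
  cfgPt fun j => frameMap ê hli (c j)

/-- The product of the profiles in the frame coordinates. [folklore] -/
def prodKer (vb : Fin (k + 2) → Fin d → ℝ) (c : Fin (k + 2) → EuclideanSpace ℝ (Fin d)) : ℂ :=
  ∏ j, prodProfile n₀ hr₁ (vb j) (c j)

/-- **`Θ_v(ζ) = ∫ S(ζ + cfgPt(frameMap∘c)) ∏ⱼ prodProfile vⱼ (cⱼ) dc`**. [cite: OsterwalderSchraderCMP1975, Ch. VI.1 (6.6)] -/
def mvTheta (S : (Fin (k + 2) → Fin d → ℂ) → ℂ) (vb : Fin (k + 2) → Fin d → ℝ) (ζ : Fin (k + 2) → Fin d → ℂ) : ℂ :=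
  ∫ c : Fin (k + 2) → EuclideanSpace ℝ (Fin d), S (ζ + frameShift ê hli c) * prodKer n₀ hr₁ vb c

/-- The frame profiles at the imaginary parts `v`. [folklore] -/
def frameProfs (vb : Fin (k + 2) → Fin d → ℝ) : Fin (k + 2) → 𝓢(EuclideanSpace ℝ (Fin d), ℂ) :=
  fun j => frameProfile ê hli n₀ hr₁ (vb j)

/-- **`Γ_v(ζ) = geomG b κ_v (cplxL L (ζ − cfgPt pbase))`**, `L = posLin⁻¹`. [cite: OsterwalderSchraderCMP1975, Ch. VI.1 (6.8)–(6.9)] -/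
def mvGamma (vb : Fin (k + 2) → Fin d → ℝ) (ζ : Fin (k + 2) → Fin d → ℂ) : ℂ :=
  geomG 𝔖 ξ ê b (frameProfs ê hli n₀ hr₁ vb)
    (cplxL ((posLinCLE (k := k) ê hli).symm.toContinuousLinearMap) (ζ - cfgPt (pbase ξ)))

end Defs

/-! ### Elementary properties of the kernel and the shift -/

section Kernel

variable {k : ℕ} (ê : Fin d → EuclideanSpace ℝ (Fin d)) (hli : LinearIndependent ℝ ê) (n₀ : ℕ) {r₁ : ℝ} (hr₁ : 0 < r₁)

omit [NeZero d] in
/-- The kernel is continuous. [folklore] -/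
theorem continuous_prodKer (vb : Fin (k + 2) → Fin d → ℝ) : Continuous (prodKer (k := k) n₀ hr₁ vb) :=
  continuous_finsetProd _ fun j _ => (prodProfile n₀ hr₁ (vb j)).continuous.comp (continuous_apply j)

omit [NeZero d] in
/-- **Support of the kernel**: `prodKer c ≠ 0` forces `‖c j‖ ≤ √(2 d r₁)` for all `j`. [folklore] -/
theorem norm_le_of_prodKer_ne_zero {vb : Fin (k + 2) → Fin d → ℝ} {c : Fin (k + 2) → EuclideanSpace ℝ (Fin d)}
    (hc : prodKer n₀ hr₁ vb c ≠ 0) (j : Fin (k + 2)) : ‖c j‖ ≤ Real.sqrt (2 * d * r₁) := by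
  have hj : prodProfile n₀ hr₁ (vb j) (c j) ≠ 0 := fun h => hc (Finset.prod_eq_zero (Finset.mem_univ j) h)
  have hmem := tsupport_prodProfile_subset n₀ hr₁ (vb j) (subset_tsupport _ (Function.mem_support.2 hj))
  rwa [mem_closedBall, dist_zero_right] at hmem

omit [NeZero d] in
/-- The kernel vanishes off the closed cube of radius `√(2 d r₁)`. [folklore] -/
theorem prodKer_eq_zero {vb : Fin (k + 2) → Fin d → ℝ} {c : Fin (k + 2) → EuclideanSpace ℝ (Fin d)}
    (hc : Real.sqrt (2 * d * r₁) < ‖c‖) : prodKer n₀ hr₁ vb c = 0 := by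
  by_contra h
  have h' := (pi_norm_le_iff_of_nonneg (Real.sqrt_nonneg _)).2 (norm_le_of_prodKer_ne_zero n₀ hr₁ h)
  linarith

omit [NeZero d] in
/-- The kernel has compact support. [folklore] -/
theorem hasCompactSupport_prodKer (vb : Fin (k + 2) → Fin d → ℝ) : HasCompactSupport (prodKer (k := k) n₀ hr₁ vb) := by
  refine HasCompactSupport.of_support_subset_isCompact (isCompact_closedBall (0 : Fin (k + 2) → EuclideanSpace ℝ (Fin d))
    (Real.sqrt (2 * d * r₁))) fun c hc => ?_
  rw [mem_closedBall, dist_zero_right]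
  by_contra h
  exact hc (prodKer_eq_zero n₀ hr₁ (lt_of_not_ge h))

omit [NeZero d] in
/-- The kernel is integrable. [folklore] -/
theorem integrable_prodKer (vb : Fin (k + 2) → Fin d → ℝ) : Integrable (prodKer (k := k) n₀ hr₁ vb) :=
  (continuous_prodKer n₀ hr₁ vb).integrable_of_hasCompactSupport (hasCompactSupport_prodKer n₀ hr₁ vb)

omit [NeZero d] in
/-- The shift is continuous in `c`. [folklore] -/
theorem continuous_frameShift : Continuous (frameShift (k := k) ê hli) := by
  refine continuous_pi fun j => continuous_pi fun μ => ?_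
  simp only [frameShift, cfgPt_apply]
  exact Complex.continuous_ofReal.comp ((PiLp.continuous_apply 2 _ μ).comp
    ((frameMap ê hli).continuous.comp (continuous_apply j)))

omit [NeZero d] in
/-- **Size of the shift**: `‖frameShift c‖ ≤ ‖frameMap‖ ‖c‖`. [folklore] -/
theorem norm_frameShift_le (c : Fin (k + 2) → EuclideanSpace ℝ (Fin d)) :
    ‖frameShift ê hli c‖ ≤ ‖(frameMap ê hli : EuclideanSpace ℝ (Fin d) →L[ℝ] EuclideanSpace ℝ (Fin d))‖ * ‖c‖ := by
  refine (norm_cfgPt_le _).trans ((pi_norm_le_iff_of_nonneg (by positivity)).2 fun j => ?_)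
  exact ((frameMap ê hli : EuclideanSpace ℝ (Fin d) →L[ℝ] EuclideanSpace ℝ (Fin d)).le_opNorm (c j)).trans
    (mul_le_mul_of_nonneg_left (norm_le_pi_norm c j) (norm_nonneg _))

omit [NeZero d] in
/-- The shift at a real configuration: `cfgPt X + frameShift c = cfgPt (X + frameMap∘c)`. [folklore] -/
theorem cfgPt_add_frameShift (X : Fin (k + 2) → EuclideanSpace ℝ (Fin d)) (c : Fin (k + 2) → EuclideanSpace ℝ (Fin d)) :
    cfgPt X + frameShift ê hli c = cfgPt fun j => X j + frameMap ê hli (c j) := by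
  funext j μ
  simp [frameShift, cfgPt_apply]

omit [NeZero d] in
/-- Geometric seminorm hypotheses for the frame profiles (from `seminorm_frameProfile_le`), packaged:
with `a₁ = J (2(n₀+1)/r₁)ᵈ`, `R₁ = max 1 (‖frameMap‖ 2√d)`, `B₁ = ‖frameMap⁻¹‖ d 6(n₀+1) max(1,(n₀+1)A/r₁)`. [folklore] -/
theorem frameProfs_geometric (hr₁1 : r₁ ≤ 1) (vb : Fin (k + 2) → Fin d → ℝ) :
    ∀ j, ∀ k' ≤ n₀, ∀ i' ≤ n₀, SchwartzMap.seminorm ℝ k' i' (frameProfs ê hli n₀ hr₁ vb j) ≤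
      (frameJac ê hli * (2 * (((n₀ : ℝ) + 1) / r₁)) ^ d) *
        max 1 (‖(frameMap ê hli : EuclideanSpace ℝ (Fin d) →L[ℝ] EuclideanSpace ℝ (Fin d))‖ * (2 * Real.sqrt d)) ^ k' *
        (‖((frameMap ê hli).symm : EuclideanSpace ℝ (Fin d) →L[ℝ] EuclideanSpace ℝ (Fin d))‖ *
          ((d : ℝ) * (6 * ((n₀ : ℝ) + 1) * max 1 (((n₀ : ℝ) + 1) / r₁ * baseDerivL1)))) ^ i' := by
  intro j k' hk' i' hi'
  refine (seminorm_frameProfile_le ê hli n₀ hr₁ hr₁1 (vb j) hk' hi').trans ?_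
  have hJ := frameJac_nonneg ê hli
  have hA := baseDerivL1_nonneg
  gcongr
  exact le_max_right _ _

omit [NeZero d] in
/-- **Support of the frame profiles**: in `closedBall 0 r₀`. [folklore] -/
theorem tsupport_frameProfs_subset {r₀ : ℝ}
    (hr₀eq : ‖(frameMap ê hli : EuclideanSpace ℝ (Fin d) →L[ℝ] EuclideanSpace ℝ (Fin d))‖ * Real.sqrt (2 * d * r₁) ≤ r₀)
    (vb : Fin (k + 2) → Fin d → ℝ) (j : Fin (k + 2)) :
    tsupport (frameProfs ê hli n₀ hr₁ vb j : EuclideanSpace ℝ (Fin d) → ℂ) ⊆ Metric.closedBall 0 r₀ :=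
  (tsupport_frameProfile_subset ê hli n₀ hr₁ (vb j)).trans (closedBall_subset_closedBall hr₀eq)

end Kernel

/-! ### Holomorphy, real values, and the identity -/

section Identity

variable (𝔖 : SchwingerFamily (EuclideanSpace ℝ (Fin d))) (hE2 : 𝔖.IsOSReflectionPositive) {k : ℕ}
  (ξ : Fin (k + 1) → EuclideanSpace ℝ (Fin d)) (ê : Fin d → EuclideanSpace ℝ (Fin d)) (hli : LinearIndependent ℝ ê) {g r₀ : ℝ}
  {b : ℝ} (hb : 0 < b) (hE1 : 𝔖.IsEuclideanCovariant)
  (hê1 : ∀ μ, ‖ê μ‖ = 1) (hêê : ∀ μ ν, 0 ≤ ⟪ê μ, ê ν⟫) (hξ : ∀ μ i', g ≤ ⟪ê μ, ξ i'⟫)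
  (hg : 2 * r₀ < g) (hr₀ : 0 ≤ r₀)
  {s : ℕ} {Cv : ℕ → ℝ} (hCv : ∀ n, 0 ≤ Cv n)
  (hv : ∀ (n : ℕ) (K : 𝓢((Fin n → EuclideanSpace ℝ (Fin d)), ℂ)) (hK : IsPositiveTimeMulti K),
    ‖ι 𝔖 hE2 (δ 𝔖 hE2 (mkGen K hK))‖ ≤ Cv n * schwartzNorm ((n + n) * s) K)
  {M : ℕ} (hM : (k + 1 + (k + 1)) * s ≤ M)
  {s₀ : ℕ} {C₀ : ℝ} (hC₀ : 0 ≤ C₀)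
  (hσ : ∀ F : 𝓢((Fin (k + 2) → EuclideanSpace ℝ (Fin d)), ℂ), ‖𝔖 (k + 2) F‖ ≤ C₀ * schwartzNorm s₀ F)
  {a R B : ℝ} (hR : 1 ≤ R) (hB : 0 ≤ B) (ha : 0 ≤ a)
  {r₁ : ℝ} (hr₁ : 0 < r₁)
  -- the local holomorphic density
  {x : Fin (k + 2) → EuclideanSpace ℝ (Fin d)} {ρ ρ₂ : ℝ} {S : (Fin (k + 2) → Fin d → ℂ) → ℂ}
  (hSd : DifferentiableOn ℂ S (ball (cfgPt x) ρ)) {Bs : ℝ} (hSB : ∀ ζ ∈ ball (cfgPt x) ρ, ‖S ζ‖ ≤ Bs)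
  (hSrep : ∀ F : 𝓢((Fin (k + 2) → EuclideanSpace ℝ (Fin d)), ℂ),
    tsupport (F : (Fin (k + 2) → EuclideanSpace ℝ (Fin d)) → ℂ) ⊆ Metric.ball x ρ → 𝔖 (k + 2) F = ∫ y, S (cfgPt y) * F y)
  -- the radii: the profile radius `r₀`, the inner radius `ρ₂`, the tail radius `rt`
  (hρ₂ : 0 < ρ₂)
  (hr₀eq : ‖(frameMap ê hli : EuclideanSpace ℝ (Fin d) →L[ℝ] EuclideanSpace ℝ (Fin d))‖ * Real.sqrt (2 * d * r₁) ≤ r₀)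
  (hρρ : ρ₂ + r₀ < ρ)
  {rt : ℝ} (hrt : ∀ j, rt ≤ tailR ((posLinCLE (k := k) ê hli).symm (x - pbase ξ)) j * Real.sin (π / (4 * (slotK k d + 1))))
  (hLρ : max ‖((posLinCLE (k := k) ê hli).symm.toContinuousLinearMap)‖
      (cplxLBound ((posLinCLE (k := k) ê hli).symm.toContinuousLinearMap)) * ρ₂ < rt)

include hSd hr₀eq hρρ hSB in
omit [NeZero d] in
/-- **`Θ_v` is holomorphic** on `ball (cfgPt x) ρ₂` (dominated holomorphic parameter integral). [cite: OsterwalderSchraderCMP1975, Ch. VI.1 (6.6)] -/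
theorem differentiableOn_mvTheta (vb : Fin (k + 2) → Fin d → ℝ) :
    DifferentiableOn ℂ (mvTheta ê hli M hr₁ S vb) (ball (cfgPt x) ρ₂) := by
  have hr₀0 : 0 ≤ r₀ := le_trans (by positivity) hr₀eq
  -- where the kernel is nonzero the shifted point stays in the big ball
  have hshift : ∀ c : Fin (k + 2) → EuclideanSpace ℝ (Fin d), prodKer M hr₁ vb c ≠ 0 → ‖frameShift ê hli c‖ ≤ r₀ := by
    intro c hc
    have hcn : ‖c‖ ≤ Real.sqrt (2 * d * r₁) := (pi_norm_le_iff_of_nonneg (Real.sqrt_nonneg _)).2 (norm_le_of_prodKer_ne_zero M hr₁ hc)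
    exact (norm_frameShift_le ê hli c).trans ((mul_le_mul_of_nonneg_left hcn (norm_nonneg _)).trans hr₀eq)
  have hin : ∀ ζ ∈ ball (cfgPt x) ρ₂, ∀ c, prodKer M hr₁ vb c ≠ 0 → ζ + frameShift ê hli c ∈ ball (cfgPt x) ρ := by
    intro ζ hζ c hc
    rw [mem_ball, dist_eq_norm] at hζ ⊢
    calc ‖ζ + frameShift ê hli c - cfgPt x‖ = ‖(ζ - cfgPt x) + frameShift ê hli c‖ := by abel_nf
      _ ≤ ‖ζ - cfgPt x‖ + ‖frameShift ê hli c‖ := norm_add_le _ _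
      _ < ρ₂ + r₀ := add_lt_add_of_lt_of_le hζ (hshift c hc)
      _ < ρ := hρρ
  refine differentiableOn_integral_of_dominated (μ := volume) (fun ζ hζ => ?_) (Eventually.of_forall fun c => ?_) fun ζ₀ hζ₀ => ?_
  · -- measurability: the integrand is continuous
    set O : Set (Fin (k + 2) → EuclideanSpace ℝ (Fin d)) := {c | ζ + frameShift ê hli c ∈ ball (cfgPt x) ρ} with hO
    have hOo : IsOpen O := isOpen_ball.preimage (continuous_const.add (continuous_frameShift ê hli))
    have hSc : ContinuousOn (fun c => S (ζ + frameShift ê hli c)) O :=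
      hSd.continuousOn.comp (continuous_const.add (continuous_frameShift ê hli)).continuousOn fun c hc => hc
    have htsupp : tsupport (prodKer M hr₁ vb) ⊆ closedBall (0 : Fin (k + 2) → EuclideanSpace ℝ (Fin d)) (Real.sqrt (2 * d * r₁)) :=
      closure_minimal (fun c hc => by
        rw [mem_closedBall, dist_zero_right]
        by_contra h
        exact hc (prodKer_eq_zero M hr₁ (lt_of_not_ge h))) isClosed_closedBall
    have hsupp : tsupport (prodKer M hr₁ vb) ⊆ O := fun c hc => by
      have hcn := htsupp hc
      rw [mem_closedBall, dist_zero_right] at hcn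
      change ζ + frameShift ê hli c ∈ ball (cfgPt x) ρ
      rw [mem_ball, dist_eq_norm] at hζ ⊢
      have hs : ‖frameShift ê hli c‖ ≤ r₀ :=
        (norm_frameShift_le ê hli c).trans ((mul_le_mul_of_nonneg_left hcn (norm_nonneg _)).trans hr₀eq)
      calc ‖ζ + frameShift ê hli c - cfgPt x‖ = ‖(ζ - cfgPt x) + frameShift ê hli c‖ := by abel_nf
        _ ≤ ‖ζ - cfgPt x‖ + ‖frameShift ê hli c‖ := norm_add_le _ _
        _ < ρ₂ + r₀ := add_lt_add_of_lt_of_le hζ hs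
        _ < ρ := hρρ
    exact (QuantumLattice.continuous_mul_of_continuousOn_tsupport_subset hOo hSc (continuous_prodKer M hr₁ vb) hsupp).aestronglyMeasurable
  · -- holomorphy in `ζ` for each `c`
    by_cases hc : prodKer M hr₁ vb c = 0
    · simp only [hc, mul_zero]; exact differentiableOn_const _
    · refine DifferentiableOn.mul_const ?_ _
      exact hSd.comp ((differentiable_id.add_const _).differentiableOn) fun ζ hζ => hin ζ hζ c hc
  · -- domination on a ball
    refine ⟨ρ₂ - dist ζ₀ (cfgPt x), by rw [mem_ball] at hζ₀; linarith, fun ζ hζ => ?_, fun c => |Bs| * ‖prodKer M hr₁ vb c‖,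
      (integrable_prodKer M hr₁ vb).norm.const_mul _, Eventually.of_forall fun c ζ hζ => ?_⟩
    · rw [mem_ball] at hζ hζ₀ ⊢
      linarith [dist_triangle ζ ζ₀ (cfgPt x)]
    · have hζ' : ζ ∈ ball (cfgPt x) ρ₂ := by
        rw [mem_ball] at hζ hζ₀ ⊢
        linarith [dist_triangle ζ ζ₀ (cfgPt x)]
      rw [norm_mul]
      by_cases hc : prodKer M hr₁ vb c = 0
      · simp [hc]
      · exact mul_le_mul_of_nonneg_right ((hSB _ (hin ζ hζ' c hc)).trans (le_abs_self _)) (norm_nonneg _)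

omit [NeZero d] in
/-- Configurations are controlled by their complex points: `‖y‖ ≤ √d ‖cfgPt y‖`. [folklore] -/
theorem norm_le_sqrt_mul_norm_cfgPt {n : ℕ} (y : Fin n → EuclideanSpace ℝ (Fin d)) : ‖y‖ ≤ Real.sqrt d * ‖cfgPt y‖ := by
  refine (pi_norm_le_iff_of_nonneg (by positivity)).2 fun j => ?_
  have h := QuantumLattice.EuclideanSpace.norm_le_sqrt_card_mul (y j) (norm_nonneg (cfgPt y)) fun μ => by
    have h1 : ‖cfgPt y j μ‖ ≤ ‖cfgPt y‖ := (norm_le_pi_norm (cfgPt y j) μ).trans (norm_le_pi_norm (cfgPt y) j)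
    rw [cfgPt_apply, Complex.norm_real, Real.norm_eq_abs] at h1
    exact h1
  simpa using h

include hLρ hρ₂ in
omit [NeZero d] in
/-- The tail radius is positive. [folklore] -/
theorem rt_pos : 0 < rt := by
  have h0 : 0 ≤ max ‖((posLinCLE (k := k) ê hli).symm.toContinuousLinearMap)‖
      (cplxLBound ((posLinCLE (k := k) ê hli).symm.toContinuousLinearMap)) := le_max_of_le_left (norm_nonneg _)
  exact lt_of_le_of_lt (by positivity) hLρ

include hLρ hρ₂ hrt in
/-- Real configurations near `x` have skeleton coordinates with positive tail coordinates. [folklore] -/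
theorem tailR_pos_of_near {X : Fin (k + 2) → EuclideanSpace ℝ (Fin d)} (hX : ‖X - x‖ < ρ₂) (j : Fin (slotK k d + 1)) :
    0 < tailR ((posLinCLE (k := k) ê hli).symm (X - pbase ξ)) j := by
  set L := (posLinCLE (k := k) ê hli).symm.toContinuousLinearMap with hL
  have hrt0 := rt_pos ê hli hρ₂ hLρ
  have hmem : (posLinCLE (k := k) ê hli).symm (X - pbase ξ) ∈ ball ((posLinCLE (k := k) ê hli).symm (x - pbase ξ)) rt := by
    rw [mem_ball, dist_eq_norm, ← map_sub, sub_sub_sub_cancel_right]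
    calc ‖(posLinCLE (k := k) ê hli).symm (X - x)‖ = ‖L (X - x)‖ := rfl
      _ ≤ ‖L‖ * ‖X - x‖ := L.le_opNorm _
      _ ≤ max ‖L‖ (cplxLBound L) * ρ₂ := mul_le_mul (le_max_left _ _) hX.le (norm_nonneg _)
          (le_max_of_le_left (norm_nonneg _))
      _ < rt := hLρ
  refine tailR_pos_of_mem_ball hmem (fun j' => ?_) j
  have h := (tailR_centre_pos hrt0 hrt j').2
  exact h.le

include hb hE1 hê1 hêê hξ hg hr₀ hCv hv hM hC₀ hσ hρ₂ hr₀eq hrt hLρ in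
/-- **`Γ_v` is holomorphic** on `ball (cfgPt x) ρ₂`. [folklore] -/
theorem differentiableOn_mvGamma (hr₁1 : r₁ ≤ 1) (vb : Fin (k + 2) → Fin d → ℝ) :
    DifferentiableOn ℂ (mvGamma 𝔖 ξ ê hli b M hr₁ vb) (ball (cfgPt x) ρ₂) := by
  set L := (posLinCLE (k := k) ê hli).symm.toContinuousLinearMap with hL
  have hgeo := frameProfs_geometric ê hli M hr₁ hr₁1 vb
  have hR1 : (1 : ℝ) ≤ max 1 (‖(frameMap ê hli : EuclideanSpace ℝ (Fin d) →L[ℝ] EuclideanSpace ℝ (Fin d))‖ * (2 * Real.sqrt d)) :=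
    le_max_left _ _
  have hB1 : (0 : ℝ) ≤ ‖((frameMap ê hli).symm : EuclideanSpace ℝ (Fin d) →L[ℝ] EuclideanSpace ℝ (Fin d))‖ *
      ((d : ℝ) * (6 * ((M : ℝ) + 1) * max 1 (((M : ℝ) + 1) / r₁ * baseDerivL1))) := by
    have := baseDerivL1_nonneg; positivity
  have ha1 : (0 : ℝ) ≤ frameJac ê hli * (2 * (((M : ℝ) + 1) / r₁)) ^ d := by
    have := frameJac_nonneg ê hli; positivity
  have hG := differentiableOn_geomG 𝔖 hE2 ξ ê hb hE1 hê1 hêê hξ hg hr₀ hCv hv hM hC₀ hσ hR1 hB1 ha1 (frameProfs ê hli M hr₁ vb)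
    (tsupport_frameProfs_subset ê hli M hr₁ hr₀eq vb) hgeo ((posLinCLE (k := k) ê hli).symm (x - pbase ξ)) hrt
  have hcentre : cplxL L (cfgPt x - cfgPt (pbase ξ)) = eRealPt ((posLinCLE (k := k) ê hli).symm (x - pbase ξ)) := by
    rw [← cfgPt_sub, cplxL_cfgPt]; rfl
  have hρA : cplxLBound L * ρ₂ < rt :=
    lt_of_le_of_lt (mul_le_mul_of_nonneg_right (le_max_right _ _) hρ₂.le) hLρ
  have hmaps : MapsTo (fun ζ => cplxL L (ζ - cfgPt (pbase ξ))) (ball (cfgPt x) ρ₂)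
      (ball (eRealPt ((posLinCLE (k := k) ê hli).symm (x - pbase ξ))) rt) := fun ζ hζ => by
    rw [← hcentre]; exact cplxL_mem_ball L hζ hρA _
  exact hG.comp (differentiable_cplxL L _).differentiableOn hmaps

include hb hE1 hê1 hêê hξ hg hCv hv hM hC₀ hσ hρ₂ hr₀eq hρρ hrt hLρ hSrep in
/-- **Real values of `Θ_v`**: at a real configuration `X` with `‖X − x‖ < ρ₂`,
`Θ_v(cfgPt X) = geomG b κ_v (eRealPt (L (X − pbase)))`. [cite: OsterwalderSchraderCMP1975, Ch. VI.1 (6.6), (6.8)] -/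
theorem mvTheta_cfgPt (hr₁1 : r₁ ≤ 1) (vb : Fin (k + 2) → Fin d → ℝ) {X : Fin (k + 2) → EuclideanSpace ℝ (Fin d)} (hX : ‖X - x‖ < ρ₂) :
    mvTheta ê hli M hr₁ S vb (cfgPt X) =
      geomG 𝔖 ξ ê b (frameProfs ê hli M hr₁ vb) (eRealPt ((posLinCLE (k := k) ê hli).symm (X - pbase ξ))) := by
  have hgeo := frameProfs_geometric ê hli M hr₁ hr₁1 vb
  have hR1 : (1 : ℝ) ≤ max 1 (‖(frameMap ê hli : EuclideanSpace ℝ (Fin d) →L[ℝ] EuclideanSpace ℝ (Fin d))‖ * (2 * Real.sqrt d)) :=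
    le_max_left _ _
  have hB1 : (0 : ℝ) ≤ ‖((frameMap ê hli).symm : EuclideanSpace ℝ (Fin d) →L[ℝ] EuclideanSpace ℝ (Fin d))‖ *
      ((d : ℝ) * (6 * ((M : ℝ) + 1) * max 1 (((M : ℝ) + 1) / r₁ * baseDerivL1))) := by
    have := baseDerivL1_nonneg; positivity
  have ha1 : (0 : ℝ) ≤ frameJac ê hli * (2 * (((M : ℝ) + 1) / r₁)) ^ d := by
    have := frameJac_nonneg ê hli; positivity
  have hr₀0 : 0 ≤ r₀ := le_trans (by positivity) hr₀eq
  -- rewrite `Θ` as a configuration-space pairing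
  have h1 : mvTheta ê hli M hr₁ S vb (cfgPt X) =
      ∫ c : Fin (k + 2) → EuclideanSpace ℝ (Fin d), (fun y => S (cfgPt y)) (fun j => X j + frameMap ê hli (c j)) *
        ∏ j, prodProfile M hr₁ (vb j) (c j) := by
    simp only [mvTheta, prodKer, cfgPt_add_frameShift]
  rw [h1, integral_mul_prod_prodProfile_eq ê hli M hr₁ (k + 2) (fun y => S (cfgPt y)) X vb]
  have h2 : (fun y : Fin (k + 2) → EuclideanSpace ℝ (Fin d) => S (cfgPt y) * ∏ j, frameProfile ê hli M hr₁ (vb j) (y j - X j)) =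
      fun y => S (cfgPt y) * SchwartzMap.tensorFin (k + 2) (frameProfs ê hli M hr₁ vb) (fun j => y j - X j) := by
    funext y; rw [SchwartzMap.tensorFin_apply]; rfl
  rw [h2]
  exact integral_density_mul_tensorFin_eq_geomG 𝔖 hE2 ξ ê hli hb hE1 hê1 hêê hξ hg hr₀0 hCv hv hM hC₀ hσ hR1 hB1 ha1
    (frameProfs ê hli M hr₁ vb) (tsupport_frameProfs_subset ê hli M hr₁ hr₀eq vb) hgeo hSrep X (by linarith)
    (tailR_pos_of_near ξ ê hli hρ₂ hrt hLρ hX)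

/-- **Real values of `Γ_v`**: `Γ_v(cfgPt X) = geomG b κ_v (eRealPt (L (X − pbase)))`. [folklore] -/
theorem mvGamma_cfgPt (vb : Fin (k + 2) → Fin d → ℝ) (X : Fin (k + 2) → EuclideanSpace ℝ (Fin d)) :
    mvGamma 𝔖 ξ ê hli b M hr₁ vb (cfgPt X) =
      geomG 𝔖 ξ ê b (frameProfs ê hli M hr₁ vb) (eRealPt ((posLinCLE (k := k) ê hli).symm (X - pbase ξ))) := by
  rw [mvGamma, ← cfgPt_sub, cplxL_cfgPt]
  rfl

include hb hE1 hê1 hêê hξ hg hr₀ hCv hv hM hC₀ hσ hρ₂ hr₀eq hρρ hrt hLρ hSd hSB hSrep in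
/-- **The identity `Θ_v = Γ_v` on the ball** (real environment + identity theorem). [cite: OsterwalderSchraderCMP1975, Ch. VI.1 (6.6)–(6.9)] -/
theorem mvTheta_eq_mvGamma (hr₁1 : r₁ ≤ 1) (vb : Fin (k + 2) → Fin d → ℝ) :
    EqOn (mvTheta ê hli M hr₁ S vb) (mvGamma 𝔖 ξ ê hli b M hr₁ vb) (ball (cfgPt x) ρ₂) := by
  have hf := differentiableOn_mvTheta (M := M) ê hli hr₁ hSd hSB hr₀eq hρρ vb
  have hg' := differentiableOn_mvGamma 𝔖 hE2 ξ ê hli hb hE1 hê1 hêê hξ hg hr₀ hCv hv hM hC₀ hσ hr₁ hρ₂ hr₀eq hrt hLρ hr₁1 vb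
  have hfa := SCV.analyticOnNhd_of_differentiableOn hf isOpen_ball
  have hga := SCV.analyticOnNhd_of_differentiableOn hg' isOpen_ball
  -- agreement at the real points of a small ball
  have hd0 : (0 : ℝ) < Real.sqrt d + 1 := by positivity
  set ρ₃ : ℝ := ρ₂ / (Real.sqrt d + 1) with hρ₃
  have hρ₃0 : 0 < ρ₃ := by positivity
  have hρ₃le : ρ₃ ≤ ρ₂ := by
    rw [hρ₃, div_le_iff₀ hd0]
    nlinarith [Real.sqrt_nonneg (d : ℝ)]
  have hev := SCV.eventually_eq_of_eq_on_reals_pi₂ (x₀ := fun j μ => x j μ) (f := mvTheta ê hli M hr₁ S vb)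
    (g := mvGamma 𝔖 ξ ê hli b M hr₁ vb) hρ₃0 (hf.mono (ball_subset_ball hρ₃le)) (hg'.mono (ball_subset_ball hρ₃le))
    (fun w hw => by
      set X : Fin (k + 2) → EuclideanSpace ℝ (Fin d) := fun j => WithLp.toLp 2 (w j) with hXdef
      have hXc : (fun a b => ((w a b : ℝ) : ℂ)) = cfgPt X := rfl
      have hxc : (fun a b => ((x a b : ℝ) : ℂ)) = cfgPt x := rfl
      rw [hXc, hxc] at hw
      rw [hXc]
      have hX : ‖X - x‖ < ρ₂ := by
        have h1 := norm_le_sqrt_mul_norm_cfgPt (X - x)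
        rw [cfgPt_sub] at h1
        calc ‖X - x‖ ≤ Real.sqrt d * ‖cfgPt X - cfgPt x‖ := h1
          _ ≤ Real.sqrt d * ρ₃ := mul_le_mul_of_nonneg_left hw.le (Real.sqrt_nonneg _)
          _ < (Real.sqrt d + 1) * ρ₃ := by nlinarith
          _ = ρ₂ := by rw [hρ₃, mul_div_cancel₀ _ hd0.ne']
      rw [mvTheta_cfgPt 𝔖 hE2 ξ ê hli hb hE1 hê1 hêê hξ hg hCv hv hM hC₀ hσ hr₁ hSrep hρ₂ hr₀eq hρρ hrt hLρ hr₁1 vb hX,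
        mvGamma_cfgPt])
  exact hfa.eqOn_of_preconnected_of_eventuallyEq hga (convex_ball _ _).isPreconnected (mem_ball_self hρ₂) hev

end Identity

end Literature.MathematicalPhysics.QuantumFieldTheory
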